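import Mathlib
import HarnessLib
import HarnessLib.Audit
import Summits.ABC.Statement
import Literature.Barriers.ABC.BakerMethodBoundsStewartTijdemanGenericProofs
import Literature.Barriers.ABC.BakerMethodBoundsEpsShape
import Summits.ABC.ABC.Theorems.PadicPrimesYuNinetyOddRadOneFinBoundThreeModFour
import Summits.ABC.ABC.Theorems.PadicPrimesYuNinetyOddRadOneFinBoundOneModFour
import Literature.Barriers.ABC.BakerMethodBounds
import HarnessLib.Audit.Status.Attr

/-!
Route: PadicPrimesKappaDoorTwoThirds

CLOSED (superseded) 2026-08-26T06:44:56Z by planner-abc-stewartyu-plan-g4-0 — reason: superseded:route-ABC-PadicPrimesW80TwoThirds — superseded by route-ABC-PadicPrimesW80TwoThirds — note: superseded 12 min after birth: p3's LANDED door Literature.Barriers.ABC.stewartYu1991_of_w80Shape (p427924) makes the three-slot KappaDoorSpec crux (≈1 kLoC, unbuilt) avoidable; same rung A1.M2, W80-binder S-texts; shared odd Fin cruxes 19455/19456 stay on route-ABC-PadicPrimesYuNinetyOddRadOne. The file is kept as the record of this route; refuted decls are indexed as negative knowledge (`ledger negatives`).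

# Route PadicPrimesKappaDoorTwoThirds — Stewart–Yu 1991 (rad^(2/3+ε)) from W80-binder p-adic bounds
for rational primes at every prime, through the cell's three-slot κ-door with κ = 1

RUNG ROUTE A1.M2, ALTERNATIVE DECOMPOSITION (D-0059/D-0061, class rung, never summit credit;
decision (i) of 2026-08-26T06:18Z on
p2-g2's memo-04, director default): it suffices to show, at EVERY prime p, a one-prime bound for
rational primes in the binder the
cell's landed p-adic architecture outputs — ord_p(∏qᵢ^(eᵢ) − 1) ≤ K·Lⁿ·nⁿ·p²·(∏log qᵢ)·log B·(log
max(3,∏qᵢ))², i.e. the κ-door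
input FinBoundAt p K L 1 2 1 2 (Yu 1990's quality nⁿ·p², Waldschmidt 1980's binder) — as three
cruxes by the prime's class
(FinBoundThreeModFour: K = ℚ twist engine with ℚ_p half-step; FinBoundOneModFour: the same with a
ℂ_[p] half-step;
FinBoundTwo: the 2-adic q = 3 engine), AND the cell's three-slot κ-door KappaDoorSpec (Stewart–Yu
1991 §3 with free powers of
log B and log ∏q ⇒ EpsShapeBound (2·max(1,κ)/3)); then κ = 1 gives EpsShapeBound (2/3), which IS
`stewartYu1991_upperBound`
(`stewartYu1991_iff_epsShapeBound`). This replaces, for staffing, the Yu-1990-shaped cruxes of route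
PadicPrimesYuNinety (log B·
loglog A to the first power), which the landed auxiliary function cannot output (memo-04 §1) and
which stay as fallback PATH Y′.
Lean: `∀ (K L κ σ : ℝ) (τ τ₁ : ℕ), 0 ≤ K → 1 ≤ L → 0 ≤ κ → 0 ≤ σ → σ ≤ 2 → (∀ p, p.Prime → (∀ (n :
ℕ) (q : Fin n → ℕ) (e : Fin n → ℤ), (∀ i, (q i).Prime) → Function.Injective q → (∀ i, q i ≠ p) → e ≠
0 → ∏ i, ((q i : ℚ)) ^ e i ≠ 1 → (padicValRat p (∏ i, ((q i : ℚ)) ^ e i - 1) : ℝ) ≤ K * L ^ n * (n :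
ℝ) ^ (κ * n) * (p : ℝ) ^ σ * (∏ i, Real.log (q i)) * Real.log (max 3 ((Finset.univ.sup fun i => (e
i).natAbs : ℕ) : ℝ)) ^ τ * Real.log (max 3 (∏ i, ((q i : ℕ) : ℝ))) ^ τ₁)) →
Literature.Barriers.ABC.EpsShapeBound (2 * max 1 κ / 3)`

## Assembly
Pure logic (`glueM2Z.lean`; farm rc 0 / 0 sorries in w80/SketchW80.lean): K, L from FinBoundMerge;
KappaDoorSpec at (κ,σ,τ,τ₁) =
(1,2,1,2) gives EpsShapeBound (2·max 1 1/3); `2·max 1 1/3 = 2/3` by norm_num;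
`stewartYu1991_iff_epsShapeBound.mpr`.

CLOSES_TARGET: closes rung F-A1.M2 of ABC: Literature.Barriers.ABC.stewartYu1991_upperBound (D-0061; not the summit Statement) — the deciding theorem of this route concludes that registered leaf instead of the Statement decl `ABC` (class rung: servable and labelled, never counted as concluding the summit Statement).

Rationale: WHY THIS LINE. Mechanism: the rung `stewartYu1991_upperBound` is rad^(2/3+ε) — polylogarithms in the
p-adic input are free — so the honest
cruxes are the statements the landed Cijsouw–Waldschmidt machine [Waldschmidt1980; tree
PadicCW77*/PadicW80Par, > 20 kLoC]
actually outputs once twisted à la Yu [Yu1990 §2: Teichmüller twist, classes mod (p−1)/2, parity bit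
at p ≡ 1 mod 4] and run in
log-p units: binder (W + m log(mV))·m log(mV) (memo-04 §1: plain derivatives τ₀! ≤ T^T and plain
powers force W⋆ ⊇ log V; Yu's
W·log V needs Baker-Δ weights, +3–4 kLoC), and the door is Stewart–Yu 1991 §3 with three p-adic
slots [StewartYu1991 (17)–(18)],
already generalised by the cell to n^(κn)·p^σ·(log B)^τ·(log Π)^τ₁ inputs at the odd places (CLOSED
stmt-ABC-19895) and begun at
all places (brick p424098). Imported: nothing outside the Baker class; cross-checks: p1 (2-adic
engine scoping), p3 (parity-bit
half-step), ref (memo-03 §2 checked sound; memo-04 §1 under check).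

RANKED CRUXES. #2 FinBoundThreeModFour (crux) — there are K ≥ 0, L ≥ 1 such that for every prime p
with p ≡ 3 (mod 4), all n, distinct primes q₁…qₙ ≠ p and exponents e ≠ 0 with ∏qᵢ^(eᵢ) ≠ 1: ord_p(∏
qᵢ^(eᵢ) − 1) ≤ K·Lⁿ·nⁿ·p²·(∏ log qᵢ)·log max(3, max|eᵢ|)·(log max(3, ∏ qᵢ))² — the κ-door input
FinBoundAt p K L 1 2 1 2 (W80 binder: ONE extra factor log max(3,∏q) against Yu 1990's log B·loglog
A), inlined Fin text of the closed OddKappaDoorSpec binder. Line (lead p2-g2, PATH Z of memo-04):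
the K = ℚ Teichmüller-twist engine on the LANDED CW77/W80 architecture run in log-p units (twins of
Setup/Functions/Series/KStep/Main, class modulus (p−1)/2 with class function ∏ηᵢ^λᵢ, ℚ_p half-step
by QR-normalisation, record TwistW80Par = W80Par + class price, log-p sizes) + a Fin transfer (αⱼ =
±qⱼ, Vⱼ = log max(p,qⱼ), W = log max(3,max|e|)). [difficulty: XL] (why it might fail: Needs engine Z
with the class price (p−1)/2 inside σ = 2 and NO residual log log p (no spare power of p when p ≫
∏q), and the (log p)-unit W80 numerics must close for every m; either failure forces σ = 2+δ / a
σ-graded door.) [Yu1990, Waldschmidt1980, StewartYu1991]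
#3 FinBoundTwo (crux) — there are K ≥ 0, L ≥ 1 such that for every prime p with p = 2, all n,
distinct primes q₁…qₙ ≠ p and exponents e ≠ 0 with ∏qᵢ^(eᵢ) ≠ 1: ord_p(∏ qᵢ^(eᵢ) − 1) ≤
K·Lⁿ·nⁿ·p²·(∏ log qᵢ)·log max(3, max|eᵢ|)·(log max(3, ∏ qᵢ))² — the κ-door input FinBoundAt p K L 1
2 1 2 (W80 binder: ONE extra factor log max(3,∏q) against Yu 1990's log B·loglog A), inlined Fin
text of the closed OddKappaDoorSpec binder. Line (WP-Y2 on the landed architecture): principal units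
αⱼ = qⱼ² ≡ 1 (mod 8), q = 3 descent over ℚ (∛α ∈ ℤ₂ by Hensel, 3^m classes by ℚ-linear independence
of ∏∛αⱼ^λⱼ, third-point Liouville by the cubic norm form; lit p421796/p424483, p1 bricks
p422573/p423648), f log p = log 2, + Fin transfer. [difficulty: XL] (why it might fail: The 2-adic
engine is unbuilt: radius-2 Schwarz constants (exp/log only on ord₂ ≥ 2/3), the Siegel count and
endgame numerics at p = 2 with q = 3 (3^m classes, cubic norms of height³) may not close inside
Lⁿ·nⁿ; generators qⱼ² cost 2ⁿ in L only.) [Yu1990, StewartYu1991, Waldschmidt1980]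
#4 FinBoundOneModFour (crux) — there are K ≥ 0, L ≥ 1 such that for every prime p with p ≡ 1 (mod
4), all n, distinct primes q₁…qₙ ≠ p and exponents e ≠ 0 with ∏qᵢ^(eᵢ) ≠ 1: ord_p(∏ qᵢ^(eᵢ) − 1) ≤
K·Lⁿ·nⁿ·p²·(∏ log qᵢ)·log max(3, max|eᵢ|)·(log max(3, ∏ qᵢ))² — the κ-door input FinBoundAt p K L 1
2 1 2 (W80 binder: ONE extra factor log max(3,∏q) against Yu 1990's log B·loglog A), inlined Fin
text of the closed OddKappaDoorSpec binder. Line: the SAME engine with p3-g2's parity-bit half-step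
outside ℚ_p (classes mod (p−1)/2 + one bit; roots ±1, ±ι; Liouville over ℚ(ι,√α) inside ℂ_[p] =
Mathlib PadicComplex, landed I1 p421340; memo-03 / CHECK-memo03). [difficulty: L] (why it might
fail: Same engine plus the half-step OUTSIDE ℚ_p (ξ² = ζ has no root in ℚ_p at p ≡ 1 mod 4): fails
if the PadicComplex/PadicAlgCl norm API cannot carry the half-step sizes, or if a log log p survives
the log-p normalisation.) [Yu1990, Waldschmidt1980]
#5 KappaDoorSpec (crux) — The THREE-slot κ-door (all places; planner's Skeleton.lean
`KappaDoorSpec`, Stewart–Yu 1991 (17)–(18) with r^(2r) ↦ r^(2κr)): a one-prime bound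
K·Lⁿ·n^(κn)·p^σ·(∏log q)·(log B)^τ·(log max(3,∏q))^τ₁ at EVERY prime with 0 ≤ σ ≤ 2 (any κ ≥ 0, τ,
τ₁) gives EpsShapeBound (2·max(1,κ)/3). Brick 1 landed:
`Summit.ABC.StewartYu.KappaDoor.log_le_of_kappaSlot_all` (p424098, one slot for an arbitrary
member); remaining: the three-slot combination with Σ n_s = 2r and the u³ endgame
(`pow_three_le_of_routes`, `le_of_pow_three_le_log`). [difficulty: M] (why it might fail: The
three-slot recombination must keep u³ ≪ K³·L^(2r)·r^(2κr)·G^σ'·polylog with σ = 2 exactly and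
general (τ,τ₁); a slot whose member is even uses P(w)^σ ≤ G-share only via the product of the three
largest primes — the tree has it for (1,1) only.) [StewartYu1991, StewartTijdeman1986]
#9 FinBoundMerge (support) — The three class bounds (p ≡ 3, p ≡ 1 mod 4, p = 2) merge into one bound
at every prime with K, L the maxima (monotonicity of K·Lⁿ; every prime is 2 or ≡ 1, 3 mod 4). Same
proof as FinBoundMergeOdd (planner Sketch) plus the p = 2 case. [difficulty: provable-now]
[StewartYu1991]

TWO-LAYER PLAN. Foreseen glued split of each engine crux into ⟨engine in unit form (stub of the
lead's skeleton: ord_p(∏αⱼ^bⱼ − 1) ≤ C(m)·p·G_cl·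
∏(Vⱼ/log p)·(W′ + m log(mV′))·m log(mV′), floors log p ≤ Vⱼ, W)⟩ + ⟨Fin transfer⟩ when the lead
registers it; KappaDoorSpec may
split into ⟨three-slot log bound (brick 1 ×3 with Σ n_s = 2r)⟩ + ⟨u³ endgame⟩ on p1's request.

KILL CRITERIA. A log log p surviving in the engine output (no spare power of p inside σ = 2)
restates the three engine cruxes to '∀ δ > 0 … σ = 2+δ'
and the door to a σ-graded exponent; a failure of the u³ endgame with general (τ,τ₁) at σ = 2 kills
KappaDoorSpec as typed
(fallback: a bespoke hY′ variant of `stewartYu1991_of_yu1990`, ≈ 1 800-line LineProofs adaptation).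
The rung itself is a theorem
in print (Stewart–Yu 1991); only typed shapes can die.

NOT DECOMPOSED YET. The engines (layers = skeleton stubs, not items); the Yu-shaped fallback PATH Y′
lives on route PadicPrimesYuNinety (items
stmt-ABC-19249–19251, transfers landed) and is not staffed unless PATH Z dies.

CHEAPEST FALSIFIER. KappaDoorSpec at κ = 1, (τ,τ₁) = (1,1): must reproduce the tree's
`stewartYu1991_of_yu1990` bookkeeping (LineProofs (17)–(18)) —
p1's first check; and each engine crux at n = 1 from the one-logarithm lemma (BC5 rungs
`finBound…_card_le_one`, WANTED any prover).

NUMBERS. κ = 1, σ = 2, τ = 1, τ₁ = 2 ⇒ exponent 2·max(1,1)/3 = 2/3 (+ε). Sizes (D-0071):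
FinBoundThreeModFour ≈ 6.5 kLoC (p2-g2 + p3-g2,
ETA 2026-08-29/30); FinBoundOneModFour ≈ 1 kLoC delta (p3-g2, 2026-08-31); FinBoundTwo ≈ 4–5 kLoC
(p1 or p4, 2026-09-01/02);
KappaDoorSpec ≈ 1 kLoC (p1, 2026-08-27/28). Rung ETA 2026-09-02 with 6 seats, 2026-08-31 with one
more prover.

Novelty: Searches run: `lean search --decl stewartYu1991_iff_epsShapeBound` (tree), `lean search 'KappaDoor'`
(odd door closed, all-places
brick 1), `ledger negatives --problem ABC` (no statement of these shapes), `lit search --hybrid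
"Waldschmidt 1980 p-adic linear forms
log B log log A binder"`, `lit search --hybrid "Stewart Yu 1991 three primes exponent two thirds"`.
Nearest prior art found: StewartYu1991
(the rung itself), Yu1990 Cor. 2.3 (the sharper binder), Waldschmidt1980 / the tree's PadicW80Par
(the binder used); route
PadicPrimesYuNinety (same rung, Yu binder). Delta: the decomposition pairs the WEAKER p-adic binder
the formalised architecture can
deliver with the cell's generalised door — a re-threading for formalisation, grade expected
known/variant (rung record).  [refs: StewartYu1991, Yu1990, Waldschmidt1980]

Barriers (technique_class: baker-linear-forms, kummer-theory): - technique_class: baker-linear-forms, kummer-theory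
- Literature.Barriers.ABC.BakerMethodBounds (Baker-class bounds are exponential in rad): it does not
evade it; the bet is a RUNG inside the class (log c ≪ rad^(2/3+ε) = Stewart–Yu 1991), class rung,
never summit credit.

History (route lifecycle, newest last):
- 2026-08-26T06:44:56Z · CLOSED superseded — superseded:route-ABC-PadicPrimesW80TwoThirds (planner-abc-stewartyu-plan-g4-0)

sub-problem: ABC · status: closed(superseded) · opened planner-abc-stewartyu-plan-g4-0 2026-08-26T06:31:20Z · rev 0 · ledger route-ABC-PadicPrimesKappaDoorTwoThirds
GENERATED by the gate from the ledger (D-0016/17). Provers cite these decls: `theorem foo : Summit.ABC.ABC.Theses.PadicPrimesKappaDoorTwoThirds.<Decl> := …` in Summits/ABC/ABC/Theorems/<Name>.lean.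
-/

namespace Summit.ABC.ABC.Theses.PadicPrimesKappaDoorTwoThirds

open scoped BigOperators Topology Manifold Classical MeasureTheory ProbabilityTheory Matrix InnerProductSpace ComplexConjugate ContinuousMap
open Filter Set Function TopologicalSpace MeasureTheory

attribute [summit_statement] _root_.ABC
attribute [summit_statement] _root_.Literature.Barriers.ABC.stewartYu1991_upperBound

open Literature.Abc

/-- item stmt-ABC-19455 · crux · rank 2 · closed · proved by Summit.ABC.ABC.Theorems.padicPrimesYuNinetyOddRadOne_finBoundThreeModFour_proof (prover) · by planner
why it might fail: Needs engine Z with the class price (p−1)/2 inside σ = 2 and NO residual log log p (no spare power of p when p ≫ ∏q), and the (log p)-unit W80 numerics must close for every m; either failure forces σ = 2+δ / a σ-graded door.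
sources: Yu1990, Waldschmidt1980, StewartYu1991
[crux] there are K ≥ 0, L ≥ 1 such that for every prime p with p ≡ 3 (mod 4), all n, distinct primes
q₁…qₙ ≠ p and exponents e ≠ 0 with ∏qᵢ^(eᵢ) ≠ 1: ord_p(∏ qᵢ^(eᵢ) − 1) ≤ K·Lⁿ·nⁿ·p²·(∏ log qᵢ)·log
max(3, max|eᵢ|)·(log max(3, ∏ qᵢ))² — the κ-door input FinBoundAt p K L 1 2 1 2 (W80 binder: ONE
extra factor log max(3,∏q) against Yu 1990's log B·loglog A), inlined Fin text of the closed
OddKappaDoorSpec binder. Line (lead p2-g2, PATH Z of memo-04): the K = ℚ Teichmüller-twist engine on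
the LANDED CW77/W80 architecture run in log-p units (twins of Setup/Functions/Series/KStep/Main,
class modulus (p−1)/2 with class function ∏ηᵢ^λᵢ, ℚ_p half-step by QR-normalisation, record
TwistW80Par = W80Par + class price, log-p sizes) + a Fin transfer (αⱼ = ±qⱼ, Vⱼ = log max(p,qⱼ), W =
log max(3,max|e|)). [difficulty: XL] -/
@[route_item "route-ABC-PadicPrimesKappaDoorTwoThirds", crux]
def FinBoundThreeModFour : Prop :=
  ∃ (K L : ℝ), 0 ≤ K ∧ 1 ≤ L ∧ ∀ p, p.Prime → p % 4 = 3 → (∀ (n : ℕ) (q : Fin n → ℕ) (e : Fin n → ℤ), (∀ i, (q i).Prime) → Function.Injective q → (∀ i, q i ≠ p) → e ≠ 0 → ∏ i, ((q i : ℚ)) ^ e i ≠ 1 → (padicValRat p (∏ i, ((q i : ℚ)) ^ e i - 1) : ℝ) ≤ K * L ^ n * (n : ℝ) ^ ((1 : ℝ) * n) * (p : ℝ) ^ (2 : ℝ) * (∏ i, Real.log (q i)) * Real.log (max 3 ((Finset.univ.sup fun i => (e i).natAbs : ℕ) : ℝ)) ^ (1 : ℕ) * Real.log (max 3 (∏ i,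 ((q i : ℕ) : ℝ))) ^ (2 : ℕ))

/-- `FinBoundThreeModFour` holds: proved by `Summit.ABC.ABC.Theorems.padicPrimesYuNinetyOddRadOne_finBoundThreeModFour_proof`. -/
theorem FinBoundThreeModFour_holds : FinBoundThreeModFour := _root_.Summit.ABC.ABC.Theorems.padicPrimesYuNinetyOddRadOne_finBoundThreeModFour_proof

/-- item stmt-ABC-19461 · crux · rank 3 · closed · moot by None · by planner
why it might fail: The 2-adic engine is unbuilt: radius-2 Schwarz constants (exp/log only on ord₂ ≥ 2/3), the Siegel count and endgame numerics at p = 2 with q = 3 (3^m classes, cubic norms of height³) may not close inside Lⁿ·nⁿ; generators qⱼ² cost 2ⁿ in L only.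
sources: Yu1990, StewartYu1991, Waldschmidt1980
[crux] there are K ≥ 0, L ≥ 1 such that for every prime p with p = 2, all n, distinct primes q₁…qₙ ≠
p and exponents e ≠ 0 with ∏qᵢ^(eᵢ) ≠ 1: ord_p(∏ qᵢ^(eᵢ) − 1) ≤ K·Lⁿ·nⁿ·p²·(∏ log qᵢ)·log max(3,
max|eᵢ|)·(log max(3, ∏ qᵢ))² — the κ-door input FinBoundAt p K L 1 2 1 2 (W80 binder: ONE extra
factor log max(3,∏q) against Yu 1990's log B·loglog A), inlined Fin text of the closed
OddKappaDoorSpec binder. Line (WP-Y2 on the landed architecture): principal units αⱼ = qⱼ² ≡ 1 (mod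
8), q = 3 descent over ℚ (∛α ∈ ℤ₂ by Hensel, 3^m classes by ℚ-linear independence of ∏∛αⱼ^λⱼ,
third-point Liouville by the cubic norm form; lit p421796/p424483, p1 bricks p422573/p423648), f log
p = log 2, + Fin transfer. [difficulty: XL] -/
@[route_item "route-ABC-PadicPrimesKappaDoorTwoThirds", crux]
def FinBoundTwo : Prop :=
  ∃ (K L : ℝ), 0 ≤ K ∧ 1 ≤ L ∧ ∀ p, p.Prime → p = 2 → (∀ (n : ℕ) (q : Fin n → ℕ) (e : Fin n → ℤ), (∀ i, (q i).Prime) → Function.Injective q → (∀ i, q i ≠ p) → e ≠ 0 → ∏ i, ((q i : ℚ)) ^ e i ≠ 1 → (padicValRat p (∏ i, ((q i : ℚ)) ^ e i - 1) : ℝ) ≤ K * L ^ n * (n : ℝ) ^ ((1 : ℝ) * n) * (p : ℝ) ^ (2 : ℝ) * (∏ i, Real.log (q i)) * Real.log (max 3 ((Finset.univ.sup fun i => (e i).natAbs : ℕ) : ℝ)) ^ (1 : ℕ) * Real.log (max 3 (∏ i, ((q i : ℕ) : ℝ))) ^ (2 : ℕ))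

/-- item stmt-ABC-19456 · crux · rank 4 · closed · proved by Summit.ABC.ABC.Theorems.padicPrimesYuNinetyOddRadOne_finBoundOneModFour_proof (prover) · by planner
why it might fail: Same engine plus the half-step OUTSIDE ℚ_p (ξ² = ζ has no root in ℚ_p at p ≡ 1 mod 4): fails if the PadicComplex/PadicAlgCl norm API cannot carry the half-step sizes, or if a log log p survives the log-p normalisation.
sources: Yu1990, Waldschmidt1980
[crux] there are K ≥ 0, L ≥ 1 such that for every prime p with p ≡ 1 (mod 4), all n, distinct primes
q₁…qₙ ≠ p and exponents e ≠ 0 with ∏qᵢ^(eᵢ) ≠ 1: ord_p(∏ qᵢ^(eᵢ) − 1) ≤ K·Lⁿ·nⁿ·p²·(∏ log qᵢ)·log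
max(3, max|eᵢ|)·(log max(3, ∏ qᵢ))² — the κ-door input FinBoundAt p K L 1 2 1 2 (W80 binder: ONE
extra factor log max(3,∏q) against Yu 1990's log B·loglog A), inlined Fin text of the closed
OddKappaDoorSpec binder. Line: the SAME engine with p3-g2's parity-bit half-step outside ℚ_p
(classes mod (p−1)/2 + one bit; roots ±1, ±ι; Liouville over ℚ(ι,√α) inside ℂ_[p] = Mathlib
PadicComplex, landed I1 p421340; memo-03 / CHECK-memo03). [difficulty: L] -/
@[route_item "route-ABC-PadicPrimesKappaDoorTwoThirds", crux]
def FinBoundOneModFour : Prop :=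
  ∃ (K L : ℝ), 0 ≤ K ∧ 1 ≤ L ∧ ∀ p, p.Prime → p % 4 = 1 → (∀ (n : ℕ) (q : Fin n → ℕ) (e : Fin n → ℤ), (∀ i, (q i).Prime) → Function.Injective q → (∀ i, q i ≠ p) → e ≠ 0 → ∏ i, ((q i : ℚ)) ^ e i ≠ 1 → (padicValRat p (∏ i, ((q i : ℚ)) ^ e i - 1) : ℝ) ≤ K * L ^ n * (n : ℝ) ^ ((1 : ℝ) * n) * (p : ℝ) ^ (2 : ℝ) * (∏ i, Real.log (q i)) * Real.log (max 3 ((Finset.univ.sup fun i => (e i).natAbs : ℕ) : ℝ)) ^ (1 : ℕ) * Real.log (max 3 (∏ i, ((q i : ℕ) : ℝ))) ^ (2 : ℕ))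

/-- `FinBoundOneModFour` holds: proved by `Summit.ABC.ABC.Theorems.padicPrimesYuNinetyOddRadOne_finBoundOneModFour_proof`. -/
theorem FinBoundOneModFour_holds : FinBoundOneModFour := _root_.Summit.ABC.ABC.Theorems.padicPrimesYuNinetyOddRadOne_finBoundOneModFour_proof

/-- item stmt-ABC-19462 · crux · rank 5 · closed · moot by None · by planner
why it might fail: The three-slot recombination must keep u³ ≪ K³·L^(2r)·r^(2κr)·G^σ'·polylog with σ = 2 exactly and general (τ,τ₁); a slot whose member is even uses P(w)^σ ≤ G-share only via the product of the three largest primes — the tree has it for (1,1) only.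
sources: StewartYu1991, StewartTijdeman1986
[crux] The THREE-slot κ-door (all places; planner's Skeleton.lean `KappaDoorSpec`, Stewart–Yu 1991
(17)–(18) with r^(2r) ↦ r^(2κr)): a one-prime bound K·Lⁿ·n^(κn)·p^σ·(∏log q)·(log B)^τ·(log
max(3,∏q))^τ₁ at EVERY prime with 0 ≤ σ ≤ 2 (any κ ≥ 0, τ, τ₁) gives EpsShapeBound (2·max(1,κ)/3).
Brick 1 landed: `Summit.ABC.StewartYu.KappaDoor.log_le_of_kappaSlot_all` (p424098, one slot for an
arbitrary member); remaining: the three-slot combination with Σ n_s = 2r and the u³ endgame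
(`pow_three_le_of_routes`, `le_of_pow_three_le_log`). [difficulty: M] -/
@[route_item "route-ABC-PadicPrimesKappaDoorTwoThirds", crux]
def KappaDoorSpec : Prop :=
  ∀ (K L κ σ : ℝ) (τ τ₁ : ℕ), 0 ≤ K → 1 ≤ L → 0 ≤ κ → 0 ≤ σ → σ ≤ 2 → (∀ p, p.Prime → (∀ (n : ℕ) (q : Fin n → ℕ) (e : Fin n → ℤ), (∀ i, (q i).Prime) → Function.Injective q → (∀ i, q i ≠ p) → e ≠ 0 → ∏ i, ((q i : ℚ)) ^ e i ≠ 1 → (padicValRat p (∏ i, ((q i : ℚ)) ^ e i - 1) : ℝ) ≤ K * L ^ n * (n : ℝ) ^ (κ * n) * (p : ℝ) ^ σ * (∏ i, Real.log (q i)) * Real.log (max 3 ((Finset.univ.sup fun i => (e i).natAbs : ℕ) : ℝ)) ^ τ * Real.log (max 3 (∏ i, ((q i : ℕ) : ℝ))) ^ τ₁)) → Literature.Barriers.ABC.EpsShapeBound (2 * max 1 κ / 3)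

/-- item stmt-ABC-19463 · support · rank 9 · closed · moot by None · by planner
sources: StewartYu1991
[support] The three class bounds (p ≡ 3, p ≡ 1 mod 4, p = 2) merge into one bound at every prime
with K, L the maxima (monotonicity of K·Lⁿ; every prime is 2 or ≡ 1, 3 mod 4). Same proof as
FinBoundMergeOdd (planner Sketch) plus the p = 2 case. [difficulty: provable-now] -/
@[route_item "route-ABC-PadicPrimesKappaDoorTwoThirds", crux]
def FinBoundMerge : Prop :=
  (∃ (K L : ℝ), 0 ≤ K ∧ 1 ≤ L ∧ ∀ p, p.Prime → p % 4 = 3 → (∀ (n : ℕ) (q : Fin n → ℕ) (e : Fin n → ℤ), (∀ i, (q i).Prime) → Function.Injective q → (∀ i, q i ≠ p) → e ≠ 0 → ∏ i, ((q i : ℚ)) ^ e i ≠ 1 → (padicValRat p (∏ i, ((q i : ℚ)) ^ e i - 1) : ℝ) ≤ K * L ^ n * (n : ℝ) ^ ((1 : ℝ) * n) * (p : ℝ) ^ (2 : ℝ) * (∏ i, Real.log (q i)) * Real.log (max 3 ((Finset.univ.sup fun i => (e i).natAbs : ℕ) : ℝ)) ^ (1 : ℕ) * Real.log (max 3 (∏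 i, ((q i : ℕ) : ℝ))) ^ (2 : ℕ))) → (∃ (K L : ℝ), 0 ≤ K ∧ 1 ≤ L ∧ ∀ p, p.Prime → p % 4 = 1 → (∀ (n : ℕ) (q : Fin n → ℕ) (e : Fin n → ℤ), (∀ i, (q i).Prime) → Function.Injective q → (∀ i, q i ≠ p) → e ≠ 0 → ∏ i, ((q i : ℚ)) ^ e i ≠ 1 → (padicValRat p (∏ i, ((q i : ℚ)) ^ e i - 1) : ℝ) ≤ K * L ^ n * (n : ℝ) ^ ((1 : ℝ) * n) * (p : ℝ) ^ (2 : ℝ) * (∏ i, Real.log (q i)) * Real.log (max 3 ((Finset.univ.sup fun i => (e i).natAbs : ℕ) : ℝ)) ^ (1 : ℕ) * Real.log (max 3 (∏ i, ((q i : ℕ) : ℝ))) ^ (2 : ℕ))) → (∃ (K L : ℝ), 0 ≤ K ∧ 1 ≤ L ∧ ∀ p, p.Prime → p = 2 → (∀ (n : ℕ) (q : Fin n → ℕ) (e : Fin n → ℤ), (∀ i, (q i).Prime) → Function.Injective q → (∀ i, q i ≠ p) → e ≠ 0 → ∏ i, ((q i : ℚ)) ^ e i ≠ 1 → (padicValRat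 p (∏ i, ((q i : ℚ)) ^ e i - 1) : ℝ) ≤ K * L ^ n * (n : ℝ) ^ ((1 : ℝ) * n) * (p : ℝ) ^ (2 : ℝ) * (∏ i, Real.log (q i)) * Real.log (max 3 ((Finset.univ.sup fun i => (e i).natAbs : ℕ) : ℝ)) ^ (1 : ℕ) * Real.log (max 3 (∏ i, ((q i : ℕ) : ℝ))) ^ (2 : ℕ))) → ∃ (K L : ℝ), 0 ≤ K ∧ 1 ≤ L ∧ ∀ p, p.Prime → (∀ (n : ℕ) (q : Fin n → ℕ) (e : Fin n → ℤ), (∀ i, (q i).Prime) → Function.Injective q → (∀ i, q i ≠ p) → e ≠ 0 → ∏ i, ((q i : ℚ)) ^ e i ≠ 1 → (padicValRat p (∏ i, ((q i : ℚ)) ^ e i - 1) : ℝ) ≤ K * L ^ n * (n : ℝ) ^ ((1 : ℝ) * n) * (p : ℝ) ^ (2 : ℝ) * (∏ i, Real.log (q i)) * Real.log (max 3 ((Finset.univ.sup fun i => (e i).natAbs : ℕ) : ℝ)) ^ (1 : ℕ) * Real.log (max 3 (∏ i, ((q i : ℕ) : ℝ))) ^ (2 : ℕ))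

/-- item stmt-ABC-19464 · assembly · rank 1 · closed · moot by None · by planner
sources: StewartYu1991
[assembly] FinBoundThreeModFour → FinBoundTwo → FinBoundOneModFour → KappaDoorSpec → FinBoundMerge →
the rung leaf stewartYu1991_upperBound (`closes_target`). [deps: FinBoundThreeModFour, FinBoundTwo,
FinBoundOneModFour, KappaDoorSpec, FinBoundMerge] [difficulty: provable-now] -/
@[route_item "route-ABC-PadicPrimesKappaDoorTwoThirds"]
def Assembly : Prop :=
  FinBoundThreeModFour → FinBoundTwo → FinBoundOneModFour → KappaDoorSpec → FinBoundMerge → Literature.Barriers.ABC.stewartYu1991_upperBound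

/-! D-0027 §2.1 — DECIDING THEOREM (planner-authored via `route open/edit --closes-file`; by planner-abc-stewartyu-plan-g4-0 2026-08-26T06:31:20Z) — ARCHIVED: route closed (superseded) 2026-08-26T06:44:56Z; kept so importers keep building:
its hypotheses are this route's items and its conclusion the registered leaf `Literature.Barriers.ABC.stewartYu1991_upperBound` (rung F-A1.M2, D-0061) (glue_lint), and it elaborates with this file. -/

@[closes "route-ABC-PadicPrimesKappaDoorTwoThirds"] theorem closes (h₃ : FinBoundThreeModFour) (h₂ : FinBoundTwo) (h₁ : FinBoundOneModFour) (hD : KappaDoorSpec) (hM : FinBoundMerge) :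
    Literature.Barriers.ABC.stewartYu1991_upperBound := by
  obtain ⟨K, L, hK, hL, h⟩ := hM h₃ h₁ h₂
  have h' : Literature.Barriers.ABC.EpsShapeBound (2 * max 1 1 / 3) :=
    hD K L 1 2 1 2 hK hL zero_le_one (by norm_num) le_rfl h
  have h'' : Literature.Barriers.ABC.EpsShapeBound (2 / 3) := by
    have e : (2 * max 1 1 / 3 : ℝ) = 2 / 3 := by norm_num
    rw [e] at h'; exact h'
  exact Literature.Barriers.ABC.stewartYu1991_iff_epsShapeBound.mpr h''

end Summit.ABC.ABC.Theses.PadicPrimesKappaDoorTwoThirds
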